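import Summits.QuantumFields.BalabanUV.Beta.GAN24.StripRegularRestrict
import Literature.MathematicalPhysics.QuantumFieldTheory.Balaban1983to89.Beta.ExpKernelCalculus

/-!
# G-an2-4 ∕ (CONV-C), S-slot node (S3-3), part 2∕2: the TWO-MOMENTUM Paley–Wiener ∕ contour-shift step —
# a jointly strip-regular symbol `G(p,q)` has a BI-LOCALISED two-momentum lattice kernel; Fubini to iterated one-momentum kernels

Self-row «S3-3-ENGINE*» of the G-an2-4 formalisation swarm (unit `b2b-balaban-gan24-formalise-leaf-14`, gen 15): node (S3-3)
«two-momentum Paley–Wiener ⇒ BiLoc» of the row owner's route «S3-fibre²» for the located remainder «E3Shape» of the stencil slot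
(cell journal l.4009; census `HOME/b2b-balaban-gan24-p1/S-SLOT.md` §3 «a two-momentum version of the Paley–Wiener step for BiLoc
(`ExpKernelCalculus.BiLoc` in both arguments; `B4ContourShift.latticeKernel_decay` twice)»; leaf-18's power count l.4019 «(S3-2) must
keep the cubic vertex as a SYMBOL» is why the symbol route, hence this final step, is the one the campaign needs).  Part 1 is
`GAN24/StripRegularRestrict` (symbol side).  HONEST FRAMING (cell rule, verbatim): «discharging `BetaPertH` makes Bałaban's UV stability
UNCONDITIONAL — a real constructive-QFT result; it is NOT the continuum limit and NOT the Clay problem.»  HONEST DEPENDENCY (verbatim):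
«continuum YM on T⁴ ⇐ BetaPertH ∧ nine spine estimates (0/9 proved); BetaPertH ⇐ (D1) ∧ (D4) ∧ CAP+tail; G-an2-4 gates asym, D1 and
NE2/3/4.»  NOT IN PRINT; OUR BOOKKEEPING: [folklore] Fourier analysis on top of pv17's generic ONE-momentum engine `B4ContourShift`
(GK 1980 Prop. A.2 ∕ B4 p. 586 «the analyticity method of proving an exponential decay»); it mentions NO object of an2's typed U = 1
system, cites nothing, mints no `Prop`, and DISCHARGES NOTHING of the wall's binders (hS, hSall) or of «E3Shape».  NOT BetaPertH, NOT
continuum, NOT Clay.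

## What is proved ([folklore], `0 sorry`)

* §3a JOINT CHARACTERS: `cphase_pair` (`e^{i(p,q)·(a,b)} = e^{ip·a}e^{iq·b}`), `stripHolo_joint_cphase`, `stripHolo_joint_trigPoly` —
  the symbol of a finite-range two-leg vertex is jointly strip holomorphic on every strip (`FibreInverseDecay.stripHolo_cphase` on
  the joint space); `stripHolo_joint_sandwich` ∕ `stripRegular_joint_sandwich` — matrix sandwiches `Σ_{i,j} A_i(p)T_{ij}(p,q)B_j(q)`
  (two-momentum fibre readouts `⟨row F(p)⁻¹, V̂(p,q) col F(q)⁻¹⟩`); `stripRegular_of_stripHolo` (holomorphy + a uniform bound).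
* §3 THE TWO-MOMENTUM LATTICE KERNEL `latticeKernel₂ G x y := latticeKernel (joint G) (pair x y)`
  `= (2π)^{−2(d+1)} ∫_{[-π,π]^{2(d+1)}} G(p,q) e^{i(p·x + q·y)} d(p,q)` and its decay, from `latticeKernel_decay` in dimension
  `2(d+1)` (GK's one-direction-at-a-time shift bounds by the sup norm of the JOINT lattice vector `(x,y)`, i.e. by
  `max(|x|_∞,|y|_∞)`): **`norm_latticeKernel₂_le`** `: StripRegular (joint G) κ M → 0 ≤ κ →
  ‖latticeKernel₂ G x y‖ ≤ M·e^{−κ·max(|x|_∞,|y|_∞)}`, hence `≤ M·e^{−(κ/2)(|x|_∞+|y|_∞)}` (`…_le_half`) and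
  `≤ M·e^{−(κ/(2(d+1)))(|x|₁+|y|₁)}` (`…_le_l1`); packaged for an2's kernel calculus: **`biLoc_of_latticeKernel₂`** — a
  matrix-fibred kernel `K : MKer (d+1) F` dominated entrywise by `‖latticeKernel₂ (G a b) (x − p) (y − q)‖` with
  `StripRegular (joint (G a b)) κ M` for all legs is `BiLoc K p q M (κ/(2(d+1)))`; variants `biLoc_of_latticeKernel₂'` (reading at
  `(x − p, q − y)`, the `e^{i(p·x − q·y)}` convention) and `biLoc_of_re_latticeKernel₂` (real-part readings, road P1's shape
  `CombesThomasFibre.KInv_eq_re_latticeKernel`).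
* §4 FUBINI: `pairEquiv : (p,q) ↦ pair p q` is a volume-preserving measurable equivalence (Mathlib's `sumPiEquivProdPi` and
  `piCongrLeft finSumFinEquiv`), `pairEquiv_preimage_BZ`, `phase_pair`, `integrand_joint_pairEquiv`, and
  **`latticeKernel₂_eq_iterated`** `: StripRegular (joint G) κ M → 0 ≤ κ → latticeKernel₂ G x y = latticeKernel (fun p ↦
  latticeKernel (G p) y) x` — the two-momentum kernel IS the iterated one-momentum kernel (inner readout in `q` at complexified `p`,
  then the `p`-readout), which is how a two-momentum fibre readout is assembled from one-momentum readouts.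
WHAT IS NOT HERE: any symbol of an2's objects, any `j`-uniform strip bound — nodes (S3-1)/(S3-2)/(S3-4) of the row owner's skeleton;
the rate is `κ/2` per leg in the sup norm (`κ/(2(d+1))` in `ℓ¹`), not `κ` (the joint shift is one coordinate at a time; immaterial
for «E3Shape», which asks `∃ δ > 0`).
-/

noncomputable section

open Complex Set MeasureTheory
open Literature.MathematicalPhysics.QuantumFieldTheory.Balaban1983to89
open Literature.MathematicalPhysics.QuantumFieldTheory.Balaban1983to89.Beta
open B4Strip (ofRealVec Strip)
open B4ContourShift (BZ latticeKernel fourierBox integrand phase supNorm StripRegular latticeKernel_decay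
  exists_supNorm_eq abs_le_supNorm supNorm_nonneg ofRealVec_mem_Strip)
open FibreInverseDecay (StripHolo BZ_nonempty sum_abs_le_mul_supNorm cphase stripHolo_cphase stripHolo_const)
open B12Sec2to5 (l1 l1_nonneg)
open ExpKernelCalculus (MKer Site BiLoc l1_sub_symm)
open Summit.QuantumFields.BalabanUV.Beta.GAN24.StripRegularRestrict

namespace Summit.QuantumFields.BalabanUV.Beta.GAN24.StripRegularBiLoc

/-! ## §3a Joint characters: the vertex symbols of finite-range two-leg objects are jointly strip holomorphic -/

section Characters

variable {d : ℕ}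

/-- [folklore] The character of a joint lattice vector factorises: `e^{i(p,q)·(a,b)} = e^{i p·a} · e^{i q·b}`, read on the joint
momentum `P` through its two halves. -/
theorem cphase_pair (a b : Fin (d + 1) → ℤ) (P : Fin (d + 1 + d + 1) → ℂ) :
    cphase (pair a b) P = cphase a (fstC P) * cphase b (sndC P) := by
  simp only [cphase, ← Complex.exp_add, ← mul_add]
  congr 2
  rw [sum_pair_index]
  simp only [pair_inl, pair_inr, fstC_apply, sndC_apply]

/-- [folklore] The joint symbol of a product of one-momentum characters is the character of the joint lattice vector. -/
theorem joint_cphase_mul_cphase (a b : Fin (d + 1) → ℤ) :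
    joint (fun p q => cphase a p * cphase b q) = cphase (pair a b) := by
  funext P
  rw [joint_apply, cphase_pair]

/-- [folklore] **TWO-MOMENTUM CHARACTERS ARE JOINTLY STRIP HOLOMORPHIC on every strip** — so every two-momentum trigonometric
polynomial `Σ_{(a,b)} c_{ab} e^{i(p·a + q·b)}` (the symbol of a finite-range two-leg vertex) is, by `StripHolo.finset_sum` and
`StripHolo.mul` with constants. -/
theorem stripHolo_joint_cphase (a b : Fin (d + 1) → ℤ) (κ : ℝ) :
    StripHolo (joint fun p q => cphase a p * cphase b q) κ := by
  rw [joint_cphase_mul_cphase]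
  exact stripHolo_cphase (pair a b) κ

/-- [folklore] A finite two-momentum trigonometric polynomial with complex coefficients is jointly strip holomorphic on every
strip. -/
theorem stripHolo_joint_trigPoly {ι : Type*} (s : Finset ι) (c : ι → ℂ) (a b : ι → Fin (d + 1) → ℤ) (κ : ℝ) :
    StripHolo (joint fun p q => ∑ m ∈ s, c m * (cphase (a m) p * cphase (b m) q)) κ := by
  have h : (joint fun p q => ∑ m ∈ s, c m * (cphase (a m) p * cphase (b m) q)) =
      fun P => ∑ m ∈ s, c m * cphase (pair (a m) (b m)) P := by
    funext P
    simp only [joint_apply, cphase_pair]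
  rw [h]
  exact StripHolo.finset_sum s fun m _ => (stripHolo_const (c m) κ).mul (stripHolo_cphase _ κ)

/-- [folklore] A strip-holomorphic symbol with an explicit sup bound on the strip is strip regular with that bound (the constructor,
named: the campaign proves `StripHolo` by algebra and the UNIFORM bound by analysis). -/
theorem stripRegular_of_stripHolo {D : ℕ} {G : (Fin (D + 1) → ℂ) → ℂ} {κ M : ℝ} (h : StripHolo G κ)
    (hM : ∀ P ∈ Strip (D + 1) κ, ‖G P‖ ≤ M) : StripRegular G κ M :=
  ⟨h.cont, h.diff, h.sides, hM⟩

/-- [folklore] **MATRIX SANDWICHES** `Σ_{i∈s} Σ_{j∈t} A_i(p)·T_{ij}(p,q)·B_j(q)` (the shape of a two-momentum fibre readout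
`⟨row(F(p)⁻¹), V̂(p,q) col(F(q)⁻¹)⟩`): one-momentum strip-holomorphic outer factors and jointly strip-holomorphic vertex entries give
a jointly strip-holomorphic symbol. -/
theorem stripHolo_joint_sandwich {ι : Type*} (s t : Finset ι) {A B : ι → (Fin (d + 1) → ℂ) → ℂ}
    {T : ι → ι → (Fin (d + 1) → ℂ) → (Fin (d + 1) → ℂ) → ℂ} {κ : ℝ} (hA : ∀ i ∈ s, StripHolo (A i) κ)
    (hT : ∀ i ∈ s, ∀ j ∈ t, StripHolo (joint (T i j)) κ) (hB : ∀ j ∈ t, StripHolo (B j) κ) :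
    StripHolo (joint fun p q => ∑ i ∈ s, ∑ j ∈ t, A i p * T i j p q * B j q) κ := by
  have h : (joint fun p q => ∑ i ∈ s, ∑ j ∈ t, A i p * T i j p q * B j q) =
      fun P => ∑ i ∈ s, ∑ j ∈ t, joint (fun p q => A i p * T i j p q * B j q) P := by
    funext P; simp only [joint_apply]
  rw [h]
  exact StripHolo.finset_sum s fun i hi => StripHolo.finset_sum t fun j hj =>
    stripHolo_joint_triple (hA i hi) (hT i hi j hj) (hB j hj)

/-- [folklore] The same with bounds: termwise strip-regular data give a jointly strip-regular sandwich with the summed product bound. -/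
theorem stripRegular_joint_sandwich {ι : Type*} (s t : Finset ι) {A B : ι → (Fin (d + 1) → ℂ) → ℂ}
    {T : ι → ι → (Fin (d + 1) → ℂ) → (Fin (d + 1) → ℂ) → ℂ} {κ : ℝ} {MA MB : ι → ℝ} {MT : ι → ι → ℝ}
    (hA : ∀ i ∈ s, StripRegular (A i) κ (MA i)) (hT : ∀ i ∈ s, ∀ j ∈ t, StripRegular (joint (T i j)) κ (MT i j))
    (hB : ∀ j ∈ t, StripRegular (B j) κ (MB j)) (hMA : ∀ i ∈ s, 0 ≤ MA i) (hMT : ∀ i ∈ s, ∀ j ∈ t, 0 ≤ MT i j) :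
    StripRegular (joint fun p q => ∑ i ∈ s, ∑ j ∈ t, A i p * T i j p q * B j q) κ
      (∑ i ∈ s, ∑ j ∈ t, MA i * MT i j * MB j) := by
  have h : (joint fun p q => ∑ i ∈ s, ∑ j ∈ t, A i p * T i j p q * B j q) =
      fun P => ∑ i ∈ s, ∑ j ∈ t, joint (fun p q => A i p * T i j p q * B j q) P := by
    funext P; simp only [joint_apply]
  rw [h]
  exact stripRegular_finset_sum s fun i hi => stripRegular_finset_sum t fun j hj =>
    stripRegular_joint_triple (hA i hi) (hT i hi j hj) (hB j hj) (hMA i hi) (hMT i hi j hj)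

end Characters

/-! ## §3 The two-momentum lattice kernel and its bi-localisation -/

section Kernel

variable {d : ℕ}

/-- [folklore] **THE TWO-MOMENTUM LATTICE KERNEL** of a symbol `G(p,q)`:
`latticeKernel₂ G x y = (2π)^{−2(d+1)} ∫_{[-π,π]^{2(d+1)}} G(p,q) e^{i(p·x + q·y)} d(p,q)` — the lattice kernel of the joint
symbol at the joint lattice vector `pair x y ∈ ℤ^{(d+1)+(d+1)}` (so a kernel `K(x,y) = ∫∫ Ĝ(p,q) e^{ip·x} e^{−iq·y}` is
`latticeKernel₂ (fun p q => Ĝ p (−q)) x y`, or `latticeKernel₂ Ĝ x (−y)`). -/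
def latticeKernel₂ (G : (Fin (d + 1) → ℂ) → (Fin (d + 1) → ℂ) → ℂ) (x y : Fin (d + 1) → ℤ) : ℂ :=
  latticeKernel (joint G) (pair x y)

/-- [folklore] The sup norm of a joint lattice vector dominates the sup norm of its first half. -/
theorem supNorm_le_supNorm_pair_left (x y : Fin (d + 1) → ℤ) : supNorm x ≤ supNorm (pair x y) := by
  obtain ⟨i, hi⟩ := exists_supNorm_eq x
  rw [hi]
  have h := abs_le_supNorm (pair x y) (inl2 i)
  rwa [pair_inl] at h

/-- [folklore] The sup norm of a joint lattice vector dominates the sup norm of its second half. -/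
theorem supNorm_le_supNorm_pair_right (x y : Fin (d + 1) → ℤ) : supNorm y ≤ supNorm (pair x y) := by
  obtain ⟨i, hi⟩ := exists_supNorm_eq y
  rw [hi]
  have h := abs_le_supNorm (pair x y) (inr2 i)
  rwa [pair_inr] at h

/-- [folklore] `max(|x|_∞, |y|_∞) ≤ |(x,y)|_∞` (in fact equality; the inequality is what the decay needs). -/
theorem max_supNorm_le_supNorm_pair (x y : Fin (d + 1) → ℤ) :
    max (supNorm x) (supNorm y) ≤ supNorm (pair x y) :=
  max_le (supNorm_le_supNorm_pair_left x y) (supNorm_le_supNorm_pair_right x y)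

/-- [folklore] The bound of a strip-regular symbol is nonnegative (evaluate at a real zone point). -/
theorem stripRegular_bound_nonneg {D : ℕ} {G : (Fin (D + 1) → ℂ) → ℂ} {κ M : ℝ} (h : StripRegular G κ M) (hκ : 0 ≤ κ) :
    0 ≤ M :=
  (norm_nonneg _).trans (h.bound _ (ofRealVec_mem_Strip hκ (BZ_nonempty (D + 1)).some_mem))

/-- [folklore] **TWO-MOMENTUM PALEY–WIENER, SUP-NORM FORM**: a jointly strip-regular symbol of half-width `κ ≥ 0` and bound `M`
has `‖latticeKernel₂ G x y‖ ≤ M · e^{−κ·max(|x|_∞, |y|_∞)}` — `B4ContourShift.latticeKernel_decay` in dimension `2(d+1)` (the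
contour is shifted in ONE coordinate of the joint momentum at a time, through real base points, exactly as GK 1980 p. 60; the best
coordinate of the joint vector `(x,y)` gives the `max`). -/
theorem norm_latticeKernel₂_le {G : (Fin (d + 1) → ℂ) → (Fin (d + 1) → ℂ) → ℂ} {κ M : ℝ}
    (h : StripRegular (joint G) κ M) (hκ : 0 ≤ κ) (x y : Fin (d + 1) → ℤ) :
    ‖latticeKernel₂ G x y‖ ≤ M * Real.exp (-(κ * max (supNorm x) (supNorm y))) := by
  have hM : 0 ≤ M := stripRegular_bound_nonneg h hκ
  refine (latticeKernel_decay h hκ (pair x y)).trans (mul_le_mul_of_nonneg_left (Real.exp_le_exp.2 ?_) hM)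
  have := max_supNorm_le_supNorm_pair x y
  nlinarith

/-- [folklore] **SUM FORM at half rate**: `‖latticeKernel₂ G x y‖ ≤ M · e^{−(κ/2)(|x|_∞ + |y|_∞)}`. -/
theorem norm_latticeKernel₂_le_half {G : (Fin (d + 1) → ℂ) → (Fin (d + 1) → ℂ) → ℂ} {κ M : ℝ}
    (h : StripRegular (joint G) κ M) (hκ : 0 ≤ κ) (x y : Fin (d + 1) → ℤ) :
    ‖latticeKernel₂ G x y‖ ≤ M * Real.exp (-(κ / 2 * (supNorm x + supNorm y))) := by
  refine (norm_latticeKernel₂_le h hκ x y).trans (mul_le_mul_of_nonneg_left (Real.exp_le_exp.2 ?_) (stripRegular_bound_nonneg h hκ))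
  have h1 := le_max_left (supNorm x) (supNorm y)
  have h2 := le_max_right (supNorm x) (supNorm y)
  nlinarith

/-- [folklore] **`ℓ¹` FORM** (an2's kernel calculus measures distances in `|·|₁ ≤ (d+1)|·|_∞`):
`‖latticeKernel₂ G x y‖ ≤ M · e^{−(κ/(2(d+1)))(|x|₁ + |y|₁)}`. -/
theorem norm_latticeKernel₂_le_l1 {G : (Fin (d + 1) → ℂ) → (Fin (d + 1) → ℂ) → ℂ} {κ M : ℝ}
    (h : StripRegular (joint G) κ M) (hκ : 0 ≤ κ) (x y : Fin (d + 1) → ℤ) :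
    ‖latticeKernel₂ G x y‖ ≤ M * Real.exp (-(κ / (2 * (d + 1))) * (l1 x + l1 y)) := by
  refine (norm_latticeKernel₂_le_half h hκ x y).trans
    (mul_le_mul_of_nonneg_left (Real.exp_le_exp.2 ?_) (stripRegular_bound_nonneg h hκ))
  have hd : (0 : ℝ) < d + 1 := by positivity
  have hx : l1 x ≤ (d + 1) * supNorm x := sum_abs_le_mul_supNorm x
  have hy : l1 y ≤ (d + 1) * supNorm y := sum_abs_le_mul_supNorm y
  have key : κ / (2 * (d + 1)) * (l1 x + l1 y) ≤ κ / 2 * (supNorm x + supNorm y) := by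
    calc κ / (2 * (d + 1)) * (l1 x + l1 y) ≤ κ / (2 * (d + 1)) * ((d + 1) * supNorm x + (d + 1) * supNorm y) :=
          mul_le_mul_of_nonneg_left (add_le_add hx hy) (div_nonneg hκ (by positivity))
      _ = κ / 2 * (supNorm x + supNorm y) := by field_simp
  linarith

/-- [folklore] **BI-LOCALISATION FROM A TWO-MOMENTUM FIBRE READOUT** (the plug into an2's `ExpKernelCalculus`): a matrix-fibred
kernel `K` on `ℤ^{d+1}` whose entries are dominated by two-momentum lattice kernels of jointly strip-regular symbols `G a b`
(half-width `κ ≥ 0`, ONE bound `M` for all legs), read at the displacements from `(p, q)`, is bi-localised at `(p, q)` with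
constant `M` and `ℓ¹`-rate `κ/(2(d+1))`. -/
theorem biLoc_of_latticeKernel₂ {F : Type*} [Fintype F] {K : MKer (d + 1) F} {p q : Site (d + 1)} {κ M : ℝ} (hκ : 0 ≤ κ)
    (G : F → F → (Fin (d + 1) → ℂ) → (Fin (d + 1) → ℂ) → ℂ) (hG : ∀ a b, StripRegular (joint (G a b)) κ M)
    (hK : ∀ x y a b, |K x y a b| ≤ ‖latticeKernel₂ (G a b) (x - p) (y - q)‖) :
    BiLoc K p q M (κ / (2 * (d + 1))) := by
  intro x y a b
  refine (hK x y a b).trans ?_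
  have h := norm_latticeKernel₂_le_l1 (hG a b) hκ (x - p) (y - q)
  convert h using 2

/-- [folklore] The same with the second displacement read as `q − y` (the `e^{i(p·x − q·y)}` convention; `|·|₁` is even). -/
theorem biLoc_of_latticeKernel₂' {F : Type*} [Fintype F] {K : MKer (d + 1) F} {p q : Site (d + 1)} {κ M : ℝ} (hκ : 0 ≤ κ)
    (G : F → F → (Fin (d + 1) → ℂ) → (Fin (d + 1) → ℂ) → ℂ) (hG : ∀ a b, StripRegular (joint (G a b)) κ M)
    (hK : ∀ x y a b, |K x y a b| ≤ ‖latticeKernel₂ (G a b) (x - p) (q - y)‖) :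
    BiLoc K p q M (κ / (2 * (d + 1))) := by
  intro x y a b
  refine (hK x y a b).trans ?_
  have h := norm_latticeKernel₂_le_l1 (hG a b) hκ (x - p) (q - y)
  rw [l1_sub_symm q y] at h
  convert h using 2

/-- [folklore] The same with the real part as the reading (the shape in which road P1 reads its kernels,
`CombesThomasFibre.KInv_eq_re_latticeKernel`): entries `K x y a b = c · Re (latticeKernel₂ (G a b) (x − p) (y − q))` with
`|c| ≤ 1`. -/
theorem biLoc_of_re_latticeKernel₂ {F : Type*} [Fintype F] {K : MKer (d + 1) F} {p q : Site (d + 1)} {κ M c : ℝ}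
    (hκ : 0 ≤ κ) (hc : |c| ≤ 1) (G : F → F → (Fin (d + 1) → ℂ) → (Fin (d + 1) → ℂ) → ℂ)
    (hG : ∀ a b, StripRegular (joint (G a b)) κ M)
    (hK : ∀ x y a b, K x y a b = c * (latticeKernel₂ (G a b) (x - p) (y - q)).re) :
    BiLoc K p q M (κ / (2 * (d + 1))) := by
  refine biLoc_of_latticeKernel₂ hκ G hG fun x y a b => ?_
  rw [hK, abs_mul]
  calc |c| * |(latticeKernel₂ (G a b) (x - p) (y - q)).re|
      ≤ 1 * ‖latticeKernel₂ (G a b) (x - p) (y - q)‖ :=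
        mul_le_mul hc (Complex.abs_re_le_norm _) (abs_nonneg _) zero_le_one
    _ = ‖latticeKernel₂ (G a b) (x - p) (y - q)‖ := one_mul _

end Kernel

/-! ## §4 The two-momentum kernel as an ITERATED one-momentum kernel (Fubini) -/

section Fubini

variable {d : ℕ}

/-- [folklore] The measurable equivalence `(p, q) ↦ pair p q` between pairs of momenta and joint momenta. -/
def pairEquiv (d : ℕ) : ((Fin (d + 1) → ℝ) × (Fin (d + 1) → ℝ)) ≃ᵐ (Fin (d + 1 + d + 1) → ℝ) :=
  (MeasurableEquiv.sumPiEquivProdPi (fun _ : Fin (d + 1) ⊕ Fin (d + 1) => ℝ)).symm.trans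
    (MeasurableEquiv.piCongrLeft (fun _ : Fin (d + 1 + d + 1) => ℝ) (@finSumFinEquiv (d + 1) (d + 1)))

/-- [folklore] `pairEquiv` preserves Lebesgue measure (product ↦ joint). -/
theorem measurePreserving_pairEquiv (d : ℕ) : MeasurePreserving (pairEquiv d) :=
  (volume_measurePreserving_sumPiEquivProdPi_symm (fun _ : Fin (d + 1) ⊕ Fin (d + 1) => ℝ)).trans
    (volume_measurePreserving_piCongrLeft (fun _ : Fin (d + 1 + d + 1) => ℝ) (@finSumFinEquiv (d + 1) (d + 1)))

/-- [folklore] `inl2 i` is `finSumFinEquiv (inl i)`. -/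
theorem inl2_eq (i : Fin (d + 1)) : inl2 i = (@finSumFinEquiv (d + 1) (d + 1)) (Sum.inl i) := by
  rw [finSumFinEquiv_apply_left]; rfl

/-- [folklore] `inr2 i` is `finSumFinEquiv (inr i)`. -/
theorem inr2_eq (i : Fin (d + 1)) : inr2 i = (@finSumFinEquiv (d + 1) (d + 1)) (Sum.inr i) := by
  rw [finSumFinEquiv_apply_right]; rfl

/-- [folklore] `pairEquiv (p, q) = pair p q`. -/
theorem pairEquiv_apply (p q : Fin (d + 1) → ℝ) : pairEquiv d (p, q) = pair p q := by
  funext l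
  rcases inl2_or_inr2 l with ⟨i, rfl⟩ | ⟨i, rfl⟩
  · rw [pair_inl, inl2_eq]
    simp only [pairEquiv, MeasurableEquiv.trans_apply]
    rw [MeasurableEquiv.piCongrLeft_apply_apply]
    rfl
  · rw [pair_inr, inr2_eq]
    simp only [pairEquiv, MeasurableEquiv.trans_apply]
    rw [MeasurableEquiv.piCongrLeft_apply_apply]
    rfl

/-- [folklore] A joint real momentum lies in the joint Brillouin zone iff both halves lie in theirs. -/
theorem pair_mem_BZ_iff (p q : Fin (d + 1) → ℝ) : pair p q ∈ BZ (d + 1 + d + 1) ↔ p ∈ BZ (d + 1) ∧ q ∈ BZ (d + 1) := by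
  simp only [BZ, Set.mem_Icc, Pi.le_def]
  constructor
  · rintro ⟨h1, h2⟩
    refine ⟨⟨fun i => ?_, fun i => ?_⟩, ⟨fun i => ?_, fun i => ?_⟩⟩
    · simpa using h1 (inl2 i)
    · simpa using h2 (inl2 i)
    · simpa using h1 (inr2 i)
    · simpa using h2 (inr2 i)
  · rintro ⟨⟨hp1, hp2⟩, ⟨hq1, hq2⟩⟩
    refine ⟨fun l => ?_, fun l => ?_⟩
    · rcases inl2_or_inr2 l with ⟨i, rfl⟩ | ⟨i, rfl⟩
      · simpa using hp1 i
      · simpa using hq1 i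
    · rcases inl2_or_inr2 l with ⟨i, rfl⟩ | ⟨i, rfl⟩
      · simpa using hp2 i
      · simpa using hq2 i

/-- [folklore] The preimage of the joint zone under `pairEquiv` is the product of the zones. -/
theorem pairEquiv_preimage_BZ (d : ℕ) : (pairEquiv d) ⁻¹' BZ (d + 1 + d + 1) = BZ (d + 1) ×ˢ BZ (d + 1) := by
  ext ⟨p, q⟩
  rw [Set.mem_preimage, Set.mem_prod, pairEquiv_apply]
  exact pair_mem_BZ_iff p q

/-- [folklore] The joint phase splits: `(p,q)·(x,y) = p·x + q·y`. -/
theorem phase_pair (p q : Fin (d + 1) → ℝ) (x y : Fin (d + 1) → ℤ) :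
    phase (pair p q) (pair x y) = phase p x + phase q y := by
  simp only [phase]
  rw [sum_pair_index]
  simp only [pair_inl, pair_inr]

/-- [folklore] The joint integrand at `pairEquiv (p, q)` factorises. -/
theorem integrand_joint_pairEquiv (G : (Fin (d + 1) → ℂ) → (Fin (d + 1) → ℂ) → ℂ) (x y : Fin (d + 1) → ℤ)
    (p q : Fin (d + 1) → ℝ) :
    integrand (joint G) (pair x y) (pairEquiv d (p, q)) = cexp (I * phase p x) * integrand (G (ofRealVec p)) y q := by
  rw [pairEquiv_apply]
  simp only [integrand, ofRealVec_pair, joint_pair, phase_pair, mul_add, Complex.exp_add]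
  ring

/-- [folklore] **FUBINI**: for a jointly strip-regular symbol the two-momentum lattice kernel is the ITERATED one-momentum
kernel — first in `q` at fixed complexified `p`, then in `p`:
`latticeKernel₂ G x y = latticeKernel (fun p ↦ latticeKernel (G p) y) x`.  (This is the form in which a two-momentum fibre
readout is assembled from one-momentum readouts.) -/
theorem latticeKernel₂_eq_iterated {G : (Fin (d + 1) → ℂ) → (Fin (d + 1) → ℂ) → ℂ} {κ M : ℝ}
    (h : StripRegular (joint G) κ M) (hκ : 0 ≤ κ) (x y : Fin (d + 1) → ℤ) :
    latticeKernel₂ G x y = latticeKernel (fun p => latticeKernel (G p) y) x := by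
  have hint : IntegrableOn (integrand (joint G) (pair x y)) (BZ (d + 1 + d + 1)) := h.integrableOn hκ (pair x y)
  have hem := measurePreserving_pairEquiv d
  have h1 : ∫ P in BZ (d + 1 + d + 1), integrand (joint G) (pair x y) P
      = ∫ z in BZ (d + 1) ×ˢ BZ (d + 1), integrand (joint G) (pair x y) (pairEquiv d z) := by
    rw [← pairEquiv_preimage_BZ]
    exact (hem.setIntegral_preimage_emb (pairEquiv d).measurableEmbedding _ _).symm
  have hint' : IntegrableOn (fun z => integrand (joint G) (pair x y) (pairEquiv d z)) (BZ (d + 1) ×ˢ BZ (d + 1))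
      ((volume : Measure (Fin (d + 1) → ℝ)).prod volume) := by
    have h2 := (hem.integrableOn_comp_preimage (pairEquiv d).measurableEmbedding).2 hint
    rw [pairEquiv_preimage_BZ] at h2
    exact h2
  have h3 : ∫ z in BZ (d + 1) ×ˢ BZ (d + 1), integrand (joint G) (pair x y) (pairEquiv d z)
      = ∫ p in BZ (d + 1), ∫ q in BZ (d + 1), integrand (joint G) (pair x y) (pairEquiv d (p, q)) := by
    rw [Measure.volume_eq_prod]
    exact setIntegral_prod _ hint'
  have h4 : ∀ p : Fin (d + 1) → ℝ, ∫ q in BZ (d + 1), integrand (joint G) (pair x y) (pairEquiv d (p, q))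
      = cexp (I * phase p x) * ∫ q in BZ (d + 1), integrand (G (ofRealVec p)) y q := by
    intro p
    rw [← integral_const_mul]
    refine setIntegral_congr_fun (by unfold BZ; exact measurableSet_Icc) fun q _ => ?_
    exact integrand_joint_pairEquiv G x y p q
  have hc : ((2 * Real.pi) ^ (d + 1 + d + 1))⁻¹ = ((2 * Real.pi) ^ (d + 1))⁻¹ * ((2 * Real.pi) ^ (d + 1))⁻¹ := by
    rw [← mul_inv, ← pow_add, ← add_assoc]
  unfold latticeKernel₂ latticeKernel fourierBox
  rw [h1, h3]
  simp_rw [h4]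
  rw [hc, ← smul_smul]
  congr 1
  rw [← integral_smul]
  refine setIntegral_congr_fun (by unfold BZ; exact measurableSet_Icc) fun p _ => ?_
  simp only [integrand, Complex.real_smul]
  ring

end Fubini

end Summit.QuantumFields.BalabanUV.Beta.GAN24.StripRegularBiLoc

end
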